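import Literature.MathematicalPhysics.QuantumFieldTheory.King1986.MinimizerTwoSpacingDeriv
import Literature.MathematicalPhysics.QuantumFieldTheory.Balaban1983to89.B4Thm110ZeroTorusUniform
import HarnessLib

/-!
# King 1986, Theorem 3.3 ∕ Prop. 3.7 (derivative clause) and Prop. 3.8 (3.71) line 2 for the ACTUAL minimiser kernels — the
# constants UNIFORM IN THE MASS `0 ≤ m² ≤ m₀²` (resp. `0 < m² ≤ m₀²`): the mass-uniform twins of
# `dminimiser_kernel_decay_blocks` and `king_prop38_deriv_torus_blocks` (`MinimizerTwoSpacingDeriv`)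

**Citation header (reproduction of PUBLISHED and PROVED work; seat `pub-ymgap-dag-n15-e` (generation 6) of the cell `pub-ymgap`,
Track-A node N15 = NE2, King-model rung; sequel of `King1986/MinimizerDecayUniform` (the same re-run for the undifferentiated
kernel) and of `King1986/MinimizerTwoSpacingDeriv`).**  C. King, *The U(1) Higgs model. I. The continuum limit*, Commun. Math.
Phys. **102** (1986) 649–677 [King1986], Theorem 3.3 (3.7) p. 658 (derivative clause), Prop. 3.7 (3.63)–(3.64) p. 663, Prop. 3.8
(3.71) p. 664 (second line), §4 pp. 672–674, and (2.20) p. 654 (the slice at scale `j` carries the mass `m²(L^jη)²`); [Ba 4] =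
T. Bałaban, *Regularity and decay of lattice Green's functions*, Commun. Math. Phys. **89** (1983) 571–597 [Balaban1983RegularityDecay],
Theorem (1.10) p. 573, clause 2 (`|(D^η_{A,μ}G_k(Ω, A)f)(x)| ≤ c₀ exp(−δ₀ dist(x, supp f))‖f‖_∞`, «constants … depending on d, M only»).

**The point.**  `MinimizerTwoSpacingDeriv.dminimiser_kernel_decay_blocks` and `king_prop38_deriv_torus_blocks` quantify the mass OUTSIDE
their `∃ δ₀ c₀` because their root `B4Thm110ZeroTorus.thm110_zero_torus` did; `B4Thm110ZeroTorusUniform.thm110_zero_torus_unif` moves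
the mass inside under a cap `m² ≤ m₀²` (both clauses).  This file re-runs the two proofs VERBATIM on the uniform root; every other
input (`dminimiser_toTor_eq`, `king_prop38_deriv_torus_of_decay` — whose Fourier-side constants `dprop38RateConst` ∕ `dprop38PosConst` ∕
`lemma43Const` carry no mass —, `aK_le`, `T_blk_le_eps_mul`, `tdistT_blockOf_toTor`, `blockOf_over`) is mass-free.  Consumer: the
King-model rung of node N15 — the gradient line (3.73)₂ of the slices of (2.17) at their physical masses, and the gradient of the
full `A = 0` fluctuation propagator summed over the slices, need ONE `(δ₀, c₀)` for all masses `m²(L^jη)² ∈ (0, m²]`.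

**What this file PROVES (kernel).**  **`dminimiser_kernel_decay_blocks_unif`** (`∃ δ₀ c₀ > 0 ∀ volumes ∀ 0 ≤ m² ≤ m₀²:
|N·(ℋ_K(x + e_μ, b) − ℋ_K(x, b))| ≤ a_K·c₀·e^{−δ₀·tdistT (B x) b}`) and **`king_prop38_deriv_torus_blocks_unif`** (`∃ δ₀ c₀ > 0 ∀ volumes
∀ n ≥ 1 ∀ 0 < m² ≤ m₀²: |∂^{η′}_μℋ_{K+n}(x′, b) − ∂^η_μℋ_K(x, b)| ≤ √((C₁′ + C₂′)(L^K)^{−γ}·2ac₀)·e^{−(δ₀∕2)·tdistT (B x) b}`) — the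
statements of the originals with `∀ m²` moved inside.

**NOT COVERED.**  The Hölder lines (`MinimizerTwoSpacingHolder`); `A ≠ 0`.  HONEST FRAMING: King's `A = 0` scalar MODEL on finite
tori; template literature; nothing about Bałaban's covariant objects; nothing continuum ∕ mass-gap ∕ Clay; count-neutral for the
cell's 27 nodes.
-/

noncomputable section

open Finset Real Matrix
open scoped BigOperators

namespace Literature.MathematicalPhysics.QuantumFieldTheory.King1986

open Literature.MathematicalPhysics.QuantumFieldTheory.Balaban1983to89 (Params)
open Literature.MathematicalPhysics.QuantumFieldTheory.Balaban1983to89.B5Prop11Plancherel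
open Literature.MathematicalPhysics.QuantumFieldTheory.Balaban1983to89.B1RG242Torus
  (lvl lvl_of_le tower Qks deriv deriv_mulVec extMat_mulVec)
open Literature.MathematicalPhysics.QuantumFieldTheory.Balaban1983to89.B5Ineq137Torus (T blk)

namespace Torus

variable {d : ℕ}

/-! ## §1 [Ba 4] (1.10) clause 2 for `∂^η_μℋ_K` in King's block-distance currency, mass-uniform -/

/-- **Mass-uniform twin of `dminimiser_kernel_decay_blocks`** (King's Theorem 3.3 (3.7) ∕ Prop. 3.7, derivative clause, for
`a_KD^ηG^η_KQ^*_K` at `A = 0`): for `d ≥ 1`, odd `L > 1`, `a > 0` and a cap `m₀² ≥ 0` there are `δ₀, c₀ > 0` (functions of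
`d, L, a, m₀²`) such that for EVERY `0 ≤ m² ≤ m₀²`, every volume `(d, L, m, K)` with `K ≥ 1`, the unit torus `M_μ = 2L^m`, every
spelling `N = L^K`, every fine point `x`, unit site `b` and direction `μ`:
`|N·(ℋ_K(x + e_μ, b) − ℋ_K(x, b))| ≤ a_K·c₀·e^{−δ₀·tdistT M (B x) b}`.  Proof = the original's with `thm110_zero_torus_unif`.
[cite: King1986, Theorem 3.3 (3.7) p.658, Prop. 3.7 (3.64) p.663; Balaban1983RegularityDecay, Theorem (1.10) p.573] -/
theorem dminimiser_kernel_decay_blocks_unif (dd L : ℕ) (hd : 1 ≤ dd) (hL : Odd L ∧ 1 < L) {a : ℝ} (ha : 0 < a)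
    {m0sq : ℝ} (hm0 : 0 ≤ m0sq) :
    ∃ δ₀ c₀ : ℝ, 0 < δ₀ ∧ 0 < c₀ ∧ ∀ (P : Params), P.d = dd → P.L = L → 1 ≤ P.K →
      ∀ (msq : ℝ), 0 ≤ msq → msq ≤ m0sq →
      ∀ (M : Fin P.d → ℕ) [∀ μ, NeZero (M μ)] (_hMK : ∀ μ, M μ = P.sitesPerDir P.K)
        (N : ℕ) [NeZero N] (_hN : N = P.L ^ P.K) (xt : Tor (fine N M)) (bt : Tor M) (μ : Fin P.d),
        |(N : ℝ) * (minimiser N M (aK a P.L P.K) (((N : ℕ) : ℝ) ^ 2) msq (Pi.single bt 1) (xt + unitVec (fine N M) μ)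
            - minimiser N M (aK a P.L P.K) (((N : ℕ) : ℝ) ^ 2) msq (Pi.single bt 1) xt)|
          ≤ aK a P.L P.K * c₀ * Real.exp (-(δ₀ * tdistT M (blockOf N M xt) bt)) := by
  obtain ⟨δ₀, c₀, hδ₀, hc₀, H⟩ := Balaban1983to89.B4Thm110ZeroTorus.thm110_zero_torus_unif dd L hd hL ha hm0
  refine ⟨δ₀, c₀ * Real.exp (2 * δ₀), hδ₀, by positivity, ?_⟩
  intro P hPd hPL hK msq hmsq hcap M _ hMK N _ hN xt bt μ
  subst hN
  have hLr : (1 : ℝ) < P.L := by exact_mod_cast P.hL.2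
  have haK : 0 < Balaban1983to89.B1.aSeq a P.L P.K := Balaban1983to89.B1.aSeq_pos ha hLr hK
  -- preimages of the King-side points under the dictionaries
  set x : Balaban1983to89.Site P 0 := (torEquiv P M hMK).symm xt with hxdef
  set b : Balaban1983to89.Site P P.K := (torUnitEquiv P M hMK).symm bt with hbdef
  have hxt : toTor P M hMK x = xt := (torEquiv P M hMK).apply_symm_apply xt
  have hbt : toTorUnit P M hMK b = bt := (torUnitEquiv P M hMK).apply_symm_apply bt
  -- the slack distance fed to Theorem 3.3
  have hε : 0 < P.eps := Params.eps_pos P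
  set TK : ℝ := T P P.K (blk P P.K x) b with hTKdef
  set D : ℝ := max 0 ((TK - 2) / P.eps) with hDdef
  have hD0 : 0 ≤ D := le_max_left _ _
  have hDle : ∀ z : Balaban1983to89.Site P 0, Balaban1983to89.Site.proj P.K P.K z = b → D ≤ T P 0 x z := by
    intro z hz
    rcases le_total ((TK - 2) / P.eps) 0 with h | h
    · rw [hDdef, max_eq_left h]
      exact Balaban1983to89.B5Ineq137Torus.T_nonneg P 0 x z
    · rw [hDdef, max_eq_right h, div_le_iff₀ hε]
      have hdom := T_blk_le_eps_mul P x z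
      rw [blk_eq_proj P z, hz] at hdom
      linarith [mul_comm P.eps (T P 0 x z)]
  have hεD : TK - 2 ≤ P.eps * D := by
    have h1 : P.eps * ((TK - 2) / P.eps) ≤ P.eps * D :=
      mul_le_mul_of_nonneg_left (le_max_right _ _) hε.le
    rwa [mul_div_cancel₀ _ hε.ne'] at h1
  -- the source `f = Q_K^* δ_b` is the indicator of the block of `b`
  have hf : ∀ z : Balaban1983to89.Site P 0,
      (Qks P P.K *ᵥ (Pi.single b (1 : ℝ) : Balaban1983to89.Site P P.K → ℝ)) z
        = if Balaban1983to89.Site.proj P.K P.K z = b then 1 else 0 := by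
    intro z
    simp only [Qks]
    rw [extMat_mulVec, lvl_of_le P (Nat.le_add_left _ _), Pi.single_apply]
  have hF : ∀ z, |(Qks P P.K *ᵥ (Pi.single b (1 : ℝ) : Balaban1983to89.Site P P.K → ℝ)) z| ≤ 1 := by
    intro z; rw [hf z]; split_ifs <;> simp
  have hsupp : ∀ z, (Qks P P.K *ᵥ (Pi.single b (1 : ℝ) : Balaban1983to89.Site P P.K → ℝ)) z ≠ 0 →
      D ≤ T P 0 x z := by
    intro z hz
    rw [hf z] at hz
    by_cases hb : Balaban1983to89.Site.proj P.K P.K z = b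
    · exact hDle z hb
    · rw [if_neg hb] at hz; exact absurd rfl hz
  have hmain := (H P hPd hPL msq hmsq hcap P.K hK le_rfl x _ 1 D hF hD0 hsupp).2 μ
  have hexp : Real.exp (-(δ₀ * (P.eps * D))) ≤ Real.exp (2 * δ₀) * Real.exp (-(δ₀ * TK)) := by
    rw [← Real.exp_add]
    apply Real.exp_le_exp.mpr
    nlinarith [mul_le_mul_of_nonneg_left hεD hδ₀.le]
  have hTKeq : tdistT M (blockOf (P.L ^ P.K) M xt) bt = TK := by
    rw [← hxt, ← hbt, tdistT_blockOf_toTor]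
  -- King's derivative in the tower's letters
  have hder : ((P.L ^ P.K : ℕ) : ℝ)
        * (minimiser (P.L ^ P.K) M (aK a P.L P.K) ((((P.L ^ P.K : ℕ) : ℝ)) ^ 2) msq (Pi.single bt 1)
            (xt + unitVec (fine (P.L ^ P.K) M) μ)
          - minimiser (P.L ^ P.K) M (aK a P.L P.K) ((((P.L ^ P.K : ℕ) : ℝ)) ^ 2) msq (Pi.single bt 1) xt)
      = Balaban1983to89.B1.aSeq a P.L P.K
        * ((deriv P 0 P.eps μ * (tower P a msq).G P.K) *ᵥ (Qks P P.K *ᵥ Pi.single b 1)) x := by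
    rw [← hxt, ← hbt, ← aSeq_eq_aK, ← eps_inv_eq P, dminimiser_toTor_eq P M hMK a msq b x μ]
  rw [hTKeq, hder, abs_mul, abs_of_pos haK, aSeq_eq_aK]
  have haK' : 0 ≤ aK a P.L P.K := by rw [← aSeq_eq_aK]; exact haK.le
  calc aK a P.L P.K * |((deriv P 0 P.eps μ * (tower P a msq).G P.K) *ᵥ (Qks P P.K *ᵥ Pi.single b 1)) x|
      ≤ aK a P.L P.K * (c₀ * Real.exp (-(δ₀ * (P.eps * D))) * 1) := mul_le_mul_of_nonneg_left hmain haK'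
    _ ≤ aK a P.L P.K * (c₀ * (Real.exp (2 * δ₀) * Real.exp (-(δ₀ * TK))) * 1) := by
        gcongr
    _ = aK a P.L P.K * (c₀ * Real.exp (2 * δ₀)) * Real.exp (-(δ₀ * TK)) := by ring

/-! ## §2 (3.71), second line, mass-uniform -/

/-- **Mass-uniform twin of `king_prop38_deriv_torus_blocks`** (King's (3.71), second line, in block-distance currency): for `d ≥ 1`,
odd `L ≥ 2`, `a > 0`, a cap `m₀² ≥ 0` and `0 ≤ γ < 1` there are `δ₀, c₀ > 0` (functions of `d, L, a, m₀²`) such that for EVERY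
`0 < m² ≤ m₀²`, every volume with `K ≥ 1`, every `n ≥ 1`, every unit site `b`, direction `μ` and fine points `x′` over `x`:
`|∂^{η′}_μℋ_{K+n}(x′, b) − ∂^η_μℋ_K(x, b)| ≤ √((C₁′ + C₂′)(L^K)^{−γ}·2ac₀)·e^{−(δ₀∕2)·tdistT M (B x) b}` — the one pair of constants
the gradient slices of (2.17) at all scales `j` (masses `m²(L^jη)²`) share. [cite: King1986, Prop. 3.8 (3.71) p.664, p.674, (2.20) p.654] -/
theorem king_prop38_deriv_torus_blocks_unif (dd L : ℕ) (hd : 1 ≤ dd) (hLodd : Odd L) (hL : 2 ≤ L) {a : ℝ} (ha : 0 < a)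
    {m0sq : ℝ} (hm0 : 0 ≤ m0sq) {γ : ℝ} (hγ0 : 0 ≤ γ) (hγ1 : γ < 1) :
    ∃ δ₀ c₀ : ℝ, 0 < δ₀ ∧ 0 < c₀ ∧ ∀ (P : Params) (_hPd : P.d = dd) (_hPL : P.L = L) (_hK : 1 ≤ P.K) [NeZero P.L]
      (m2 : ℝ) (_hm : 0 < m2) (_hcap : m2 ≤ m0sq)
      (n : ℕ) (_hn : 1 ≤ n) (M : Fin P.d → ℕ) [∀ μ, NeZero (M μ)] (_hMK : ∀ μ, M μ = P.sitesPerDir P.K)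
      (xt : Tor (fine (P.L ^ P.K) M)) (xt' : Tor (fine (P.L ^ n * P.L ^ P.K) M)) (bt : Tor M)
      (_hxx : ∀ μ, (xt μ).val = (xt' μ).val / P.L ^ n) (μ : Fin P.d),
      |((P.L ^ n * P.L ^ P.K : ℕ) : ℝ)
          * (minimiser (P.L ^ n * P.L ^ P.K) M (aK a P.L (P.K + n)) (((P.L ^ n * P.L ^ P.K : ℕ) : ℝ) ^ 2) m2
              (Pi.single bt 1) (xt' + unitVec (fine (P.L ^ n * P.L ^ P.K) M) μ)
            - minimiser (P.L ^ n * P.L ^ P.K) M (aK a P.L (P.K + n)) (((P.L ^ n * P.L ^ P.K : ℕ) : ℝ) ^ 2) m2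
              (Pi.single bt 1) xt')
        - ((P.L ^ P.K : ℕ) : ℝ)
          * (minimiser (P.L ^ P.K) M (aK a P.L P.K) (((P.L ^ P.K : ℕ) : ℝ) ^ 2) m2 (Pi.single bt 1)
              (xt + unitVec (fine (P.L ^ P.K) M) μ)
            - minimiser (P.L ^ P.K) M (aK a P.L P.K) (((P.L ^ P.K : ℕ) : ℝ) ^ 2) m2 (Pi.single bt 1) xt)|
        ≤ Real.sqrt (((dprop38RateConst a a (lemma43Const a P.L P.K n) ((π ^ 2 / 4) ^ P.d) P.d γ
                + dprop38PosConst a ((π ^ 2 / 4) ^ P.d) P.d γ) * ((P.L ^ P.K : ℕ) : ℝ) ^ (-γ)) * (2 * (a * c₀)))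
            * Real.exp (-(δ₀ / 2 * tdistT M (blockOf (P.L ^ P.K) M xt) bt)) := by
  have hL1 : 1 < L := by omega
  obtain ⟨δ₀, c₀, hδ₀, hc₀, H⟩ := dminimiser_kernel_decay_blocks_unif dd L hd ⟨hLodd, hL1⟩ ha hm0
  refine ⟨δ₀, c₀, hδ₀, hc₀, ?_⟩
  intro P hPd hPL hK _ m2 hm hcap n hn M _ hMK xt xt' bt hxx μ
  have hLr : (1 : ℝ) < P.L := by exact_mod_cast P.hL.2
  have hPd0 : 0 < P.d := by have := P.hd; omega
  have hPodd : Odd P.L := P.hL.1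
  have hPL2 : 2 ≤ P.L := by have := P.hL.2; omega
  -- run A: volume `P`
  have hA := H P hPd hPL hK m2 hm.le hcap M hMK (P.L ^ P.K) rfl xt bt μ
  have hdecA := hA.trans (mul_le_mul_of_nonneg_right (mul_le_mul_of_nonneg_right (aK_le ha hLr hK) hc₀.le)
    (Real.exp_pos (-(δ₀ * tdistT M (blockOf (P.L ^ P.K) M xt) bt))).le)
  -- run B: volume `(d, L, m, K + n)` over the same unit torus
  have hMK' : ∀ ν, M ν = (⟨P.d, P.L, P.m, P.K + n, P.hd, P.hL⟩ : Params).sitesPerDir (P.K + n) := fun ν => by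
    rw [hMK ν]; exact (sitesPerDir_finerVolume P n).symm
  have hN : P.L ^ n * P.L ^ P.K = P.L ^ (P.K + n) := by rw [pow_add, mul_comm]
  have hB := H (⟨P.d, P.L, P.m, P.K + n, P.hd, P.hL⟩ : Params) hPd hPL (show 1 ≤ P.K + n by omega) m2 hm.le hcap M hMK'
    (P.L ^ n * P.L ^ P.K) hN xt' bt μ
  rw [blockOf_over M xt xt' hxx] at hB
  have hdecB := hB.trans (mul_le_mul_of_nonneg_right (mul_le_mul_of_nonneg_right
      (aK_le ha hLr (show 1 ≤ P.K + n by omega)) hc₀.le)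
    (Real.exp_pos (-(δ₀ * tdistT M (blockOf (P.L ^ P.K) M xt) bt))).le)
  exact king_prop38_deriv_torus_of_decay hPd0 hPodd hPL2 hK hn M ha hm hγ0 hγ1 bt xt xt' hxx μ hdecA hdecB

end Torus

end Literature.MathematicalPhysics.QuantumFieldTheory.King1986
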